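import Summits.AtomisticToContinuum.BoseEinsteinCondensation.Theorems.BECGroundStateSOSPeriodicIRBoundFsumOccFourier
import Literature.MathematicalPhysics.QuantumManyBody.PeriodicConfigFourier
import HarnessLib

/-!
# Crux `PeriodicIRBound` (stmt-AtomisticToContinuum-3972), line `fsum-phase-pencil`, helper S5-M
# `stub_fsumMomentIneq` — the condensate moment inequality

For a normalised core state `Ψ` of `N = n + 2` bosons on the torus `(ℝ³/Lℤ³)`, a momentum `k ≠ 0`, the
number operators `n_q = a_q† a_q` of the plane waves and `n̄₀ = ⟨n₀⟩ > N/2`: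

  `N ⟨n_k⟩ − ⟨n₀ n_k⟩ ≤ (N/2) ⟨n_k⟩ + N · (⟨n₀²⟩ − n̄₀²) / (n̄₀ − N/2)`.

In the momentum representation (`stub_fsumOccFourier`) the four moments `⟨n_k⟩ = ‖a_kΨ‖²`,
`⟨n₀ n_k⟩ = ‖a_k a_0Ψ‖²`, `n̄₀ = ‖a_0Ψ‖²`, `⟨n₀(n₀ − 1)⟩ = ‖a_0 a_0Ψ‖²` are the averages of the polynomials
`y`, `x y`, `x`, `x (x − 1)` in the multiplicities `x = m_0(ν)`, `y = m_k(ν)` (`0 ≤ x, y ≤ N`) against the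
probability weights `w_ν = L^{3N} |ĉ_ν(Ψ)|²` (Parseval), and the claim is the average of the pointwise
inequality `(N − x) y ≤ (N/2) y + N (c − x)² / (c − N/2)` (`MomentIneq.pointwise`) at `c = n̄₀`.
-/

noncomputable section

open MeasureTheory Filter
open scoped ENNReal NNReal ComplexConjugate BigOperators

namespace Summit.AtomisticToContinuum.BoseEinsteinCondensation.Cruxes.PeriodicIRBound.FsumPhasePencil

open Literature.MathematicalPhysics.QuantumManyBody.BoseGas
open Summit.AtomisticToContinuum.BoseEinsteinCondensation.Cruxes.PeriodicIRBound.LinearPhFloorWagner.WF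

namespace MomentIneq

/-! ## The pointwise inequality and its average against probability weights -/

/-- The pointwise polynomial inequality: for real `x`, `0 ≤ y ≤ N` and `c > N/2`,
`(N − x) y ≤ (N/2) y + N (c − x)² / (c − N/2)`. [folklore] -/
theorem pointwise {N c x y : ℝ} (hy : 0 ≤ y) (hyN : y ≤ N) (hc : N / 2 < c) :
    (N - x) * y ≤ N / 2 * y + N * (c - x) ^ 2 / (c - N / 2) := by
  have hd : 0 < c - N / 2 := sub_pos.2 hc
  have hN : 0 ≤ N := hy.trans hyN
  rw [← sub_le_iff_le_add', le_div_iff₀ hd]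
  rcases le_or_gt (N / 2) x with hxN | hxN
  · have h1 : (N - x) * y - N / 2 * y ≤ 0 := by nlinarith
    have h2 : 0 ≤ N * (c - x) ^ 2 := by positivity
    nlinarith
  · have h1 : (N / 2 - x) * y ≤ (N / 2 - x) * N := mul_le_mul_of_nonneg_left hyN (by linarith)
    have h2 : (N / 2 - x) * N ≤ (c - x) * N := mul_le_mul_of_nonneg_right (by linarith) hN
    have h3 : 0 ≤ (c - x) * N := mul_nonneg (by linarith) hN
    have h4 : c - N / 2 ≤ c - x := by linarith
    calc ((N - x) * y - N / 2 * y) * (c - N / 2) = (N / 2 - x) * y * (c - N / 2) := by ring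
      _ ≤ (c - x) * N * (c - N / 2) := mul_le_mul_of_nonneg_right (h1.trans h2) hd.le
      _ ≤ (c - x) * N * (c - x) := mul_le_mul_of_nonneg_left h4 h3
      _ = N * (c - x) ^ 2 := by ring

variable {ι : Type*}

/-- A nonnegative bounded sequence times a nonnegative summable one is summable. [folklore] -/
theorem summable_mul_of_le {p : ι → ℝ} (hp0 : ∀ i, 0 ≤ p i) (hp : Summable p) {g : ι → ℝ} {B : ℝ}
    (hg0 : ∀ i, 0 ≤ g i) (hg : ∀ i, g i ≤ B) : Summable fun i => g i * p i := by
  refine Summable.of_norm_bounded (hp.mul_left B) fun i => ?_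
  rw [Real.norm_eq_abs, abs_of_nonneg (mul_nonneg (hg0 i) (hp0 i))]
  exact mul_le_mul_of_nonneg_right (hg i) (hp0 i)

/-- `m (m − 1) + m = m²` for naturals (with truncated subtraction), cast to `ℝ`. [folklore] -/
theorem natCast_mul_pred_add_self (m : ℕ) : ((m * (m - 1) : ℕ) : ℝ) + m = (m : ℝ) ^ 2 := by
  cases m with
  | zero => simp
  | succ m =>
    push_cast [Nat.add_sub_cancel]
    ring

/-- **The averaged inequality**: for probability weights `p` and natural `x, y ≤ N` with
`c = ∑ x p > N/2`, `N ∑ y p − ∑ x y p ≤ (N/2) ∑ y p + N (∑ x(x−1) p + c − c²) / (c − N/2)`. [folklore] -/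
theorem tsum_ineq {p : ι → ℝ} (hp0 : ∀ i, 0 ≤ p i) (hp : Summable p) (hp1 : ∑' i, p i = 1)
    {x y : ι → ℕ} {N : ℝ} (hxN : ∀ i, (x i : ℝ) ≤ N) (hyN : ∀ i, (y i : ℝ) ≤ N)
    (hc : N / 2 < ∑' i, (x i : ℝ) * p i) :
    N * ∑' i, (y i : ℝ) * p i - ∑' i, ((x i * y i : ℕ) : ℝ) * p i ≤
      N / 2 * ∑' i, (y i : ℝ) * p i +
        N * ((∑' i, ((x i * (x i - 1) : ℕ) : ℝ) * p i) + (∑' i, (x i : ℝ) * p i) -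
          (∑' i, (x i : ℝ) * p i) ^ 2) / ((∑' i, (x i : ℝ) * p i) - N / 2) := by
  set c := ∑' i, (x i : ℝ) * p i with hc_def
  have hX : HasSum (fun i => (x i : ℝ) * p i) c :=
    (summable_mul_of_le hp0 hp (fun i => Nat.cast_nonneg _) hxN).hasSum
  have hY : HasSum (fun i => (y i : ℝ) * p i) (∑' i, (y i : ℝ) * p i) :=
    (summable_mul_of_le hp0 hp (fun i => Nat.cast_nonneg _) hyN).hasSum
  have hXY : HasSum (fun i => ((x i * y i : ℕ) : ℝ) * p i) (∑' i, ((x i * y i : ℕ) : ℝ) * p i) := by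
    refine (summable_mul_of_le hp0 hp (fun i => Nat.cast_nonneg _) (B := N * N) fun i => ?_).hasSum
    push_cast
    exact mul_le_mul (hxN i) (hyN i) (Nat.cast_nonneg _) ((Nat.cast_nonneg _).trans (hxN i))
  have hXX : HasSum (fun i => ((x i * (x i - 1) : ℕ) : ℝ) * p i)
      (∑' i, ((x i * (x i - 1) : ℕ) : ℝ) * p i) := by
    refine (summable_mul_of_le hp0 hp (fun i => Nat.cast_nonneg _) (B := N * N) fun i => ?_).hasSum
    have h1 : ((x i - 1 : ℕ) : ℝ) ≤ N := (Nat.cast_le.mpr (Nat.sub_le (x i) 1)).trans (hxN i)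
    rw [Nat.cast_mul]
    exact mul_le_mul (hxN i) h1 (Nat.cast_nonneg _) ((Nat.cast_nonneg _).trans (hxN i))
  have hP : HasSum p 1 := hp1 ▸ hp.hasSum
  have hsq : ∀ i, ((x i * (x i - 1) : ℕ) : ℝ) = (x i : ℝ) ^ 2 - x i := fun i => by
    rw [← natCast_mul_pred_add_self (x i)]
    ring
  -- the two sides as sums
  have hL : HasSum (fun i => ((N - x i) * y i) * p i)
      (N * (∑' i, (y i : ℝ) * p i) - ∑' i, ((x i * y i : ℕ) : ℝ) * p i) := by
    have heq : (fun i => ((N - x i) * y i) * p i) =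
        fun i => N * ((y i : ℝ) * p i) - ((x i * y i : ℕ) : ℝ) * p i := by
      funext i
      push_cast
      ring
    rw [heq]
    exact (hY.mul_left N).sub hXY
  have hR : HasSum (fun i => (N / 2 * y i + N * (c - x i) ^ 2 / (c - N / 2)) * p i)
      (N / 2 * (∑' i, (y i : ℝ) * p i) +
        N * ((∑' i, ((x i * (x i - 1) : ℕ) : ℝ) * p i) + c - c ^ 2) / (c - N / 2)) := by
    have heq : (fun i => (N / 2 * y i + N * (c - x i) ^ 2 / (c - N / 2)) * p i) =
        fun i => N / 2 * ((y i : ℝ) * p i) + N / (c - N / 2) *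
          (c ^ 2 * p i - 2 * c * ((x i : ℝ) * p i) + (((x i * (x i - 1) : ℕ) : ℝ) * p i + (x i : ℝ) * p i)) := by
      funext i
      rw [hsq i]
      ring
    have hval : N / 2 * (∑' i, (y i : ℝ) * p i) +
        N * ((∑' i, ((x i * (x i - 1) : ℕ) : ℝ) * p i) + c - c ^ 2) / (c - N / 2) =
          N / 2 * (∑' i, (y i : ℝ) * p i) + N / (c - N / 2) *
            (c ^ 2 * 1 - 2 * c * c + ((∑' i, ((x i * (x i - 1) : ℕ) : ℝ) * p i) + c)) := by
      ring
    rw [heq, hval]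
    exact (hY.mul_left (N / 2)).add
      ((((hP.mul_left (c ^ 2)).sub (hX.mul_left (2 * c))).add (hXX.add hX)).mul_left (N / (c - N / 2)))
  exact hasSum_le (fun i => mul_le_mul_of_nonneg_right
    (pointwise (Nat.cast_nonneg _) (hyN i) hc) (hp0 i)) hL hR

/-! ## From `ℝ≥0∞`-valued weights to real averages -/

/-- For finite-mass weights `W`, `(∑ g W).toReal = ∑ g · W.toReal` for natural `g`. [folklore] -/
theorem toReal_tsum_natCast_mul {W : ι → ℝ≥0∞} (hW : ∑' i, W i ≠ ⊤) (g : ι → ℕ) :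
    (∑' i, (g i : ℝ≥0∞) * W i).toReal = ∑' i, (g i : ℝ) * (W i).toReal := by
  rw [ENNReal.tsum_toReal_eq fun i =>
    ENNReal.mul_ne_top (ENNReal.natCast_ne_top _) (ENNReal.ne_top_of_tsum_ne_top hW i)]
  simp only [ENNReal.toReal_mul, ENNReal.toReal_natCast]

/-- **The averaged inequality, `ℝ≥0∞` weights**: for weights `W` of total mass `1` and natural
`x, y ≤ N` with `c = (∑ x W).toReal > N/2`,
`N (∑ y W) − (∑ x y W) ≤ (N/2) (∑ y W) + N ((∑ x(x−1) W) + c − c²) / (c − N/2)`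
(all sums `.toReal`). [folklore] -/
theorem toReal_tsum_ineq {W : ι → ℝ≥0∞} (hW : ∑' i, W i = 1) {x y : ι → ℕ} {N : ℝ}
    (hxN : ∀ i, (x i : ℝ) ≤ N) (hyN : ∀ i, (y i : ℝ) ≤ N)
    (hc : N / 2 < (∑' i, (x i : ℝ≥0∞) * W i).toReal) :
    N * (∑' i, (y i : ℝ≥0∞) * W i).toReal - (∑' i, ((x i * y i : ℕ) : ℝ≥0∞) * W i).toReal ≤
      N / 2 * (∑' i, (y i : ℝ≥0∞) * W i).toReal +
        N * ((∑' i, ((x i * (x i - 1) : ℕ) : ℝ≥0∞) * W i).toReal +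
            (∑' i, (x i : ℝ≥0∞) * W i).toReal - (∑' i, (x i : ℝ≥0∞) * W i).toReal ^ 2) /
          ((∑' i, (x i : ℝ≥0∞) * W i).toReal - N / 2) := by
  have hW' : ∑' i, W i ≠ ⊤ := hW ▸ ENNReal.one_ne_top
  simp only [toReal_tsum_natCast_mul hW'] at hc ⊢
  have hp1 : ∑' i, (W i).toReal = 1 := by
    rw [← ENNReal.tsum_toReal_eq (ENNReal.ne_top_of_tsum_ne_top hW'), hW, ENNReal.toReal_one]
  exact tsum_ineq (fun i => ENNReal.toReal_nonneg) (ENNReal.summable_toReal hW') hp1 hxN hyN hc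

/-! ## The moments of a core state through the Fourier weights -/

variable {n : ℕ} {L : ℝ}

/-- `‖a_qΨ‖² = ∑_ν m_q(ν) w_ν`, `w_ν = L^{3N} |ĉ_ν(Ψ)|²`, for a core `N = n+2`-body `Ψ`. [folklore] -/
theorem normSq_modeAn_eq_tsum_weight (hL : 0 < L) (q : Fin 3 → ℤ) {Ψ : Config (n + 2) → ℂ}
    (hΨ : IsCore L Ψ) :
    normSq L (modeAn L (planeWaveMode L q) Ψ) = ∑' ν : Fin (n + 2) × Fin 3 → ℤ,
      ((Finset.univ.filter fun j : Fin (n + 2) => (fun c => ν (j, c)) = q).card : ℝ≥0∞) *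
        ((ENNReal.ofReal L ^ 3) ^ (n + 2) * (‖configFourierCoeff L Ψ ν‖₊ : ℝ≥0∞) ^ 2) := by
  rw [OccFourier.normSq_modeAn_eq_tsum_card hL q hΨ, ← ENNReal.tsum_mul_left]
  exact tsum_congr fun ν => by ring

/-- `‖a_p a_qΨ‖² = ∑_ν m_q(ν) (m_p(ν) − δ_{pq}) w_ν` for a core `N = n+2`-body `Ψ`. [folklore] -/
theorem normSq_modeAn_modeAn_eq_tsum_weight (hL : 0 < L) (p q : Fin 3 → ℤ) {Ψ : Config (n + 2) → ℂ}
    (hΨ : IsCore L Ψ) :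
    normSq L (modeAn L (planeWaveMode L p) (modeAn L (planeWaveMode L q) Ψ)) =
      ∑' ν : Fin (n + 2) × Fin 3 → ℤ,
        (((Finset.univ.filter fun j : Fin (n + 2) => (fun c => ν (j, c)) = q).card *
            ((Finset.univ.filter fun j : Fin (n + 2) => (fun c => ν (j, c)) = p).card -
              if p = q then 1 else 0) : ℕ) : ℝ≥0∞) *
          ((ENNReal.ofReal L ^ 3) ^ (n + 2) * (‖configFourierCoeff L Ψ ν‖₊ : ℝ≥0∞) ^ 2) := by
  rw [OccFourier.normSq_modeAn_modeAn_eq_tsum_card hL p q hΨ, ← ENNReal.tsum_mul_left]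
  refine tsum_congr fun ν => ?_
  rw [Nat.cast_mul, ENNReal.natCast_sub, Nat.cast_ite, Nat.cast_one, Nat.cast_zero]
  ring

/-- Parseval for a normalised state: the weights `w_ν = L^{3N} |ĉ_ν(Ψ)|²` have total mass `1`. [folklore] -/
theorem tsum_weight_eq_one (hL : 0 < L) (Ψ : PeriodicTrialState (n + 2) L) :
    ∑' ν : Fin (n + 2) × Fin 3 → ℤ,
      (ENNReal.ofReal L ^ 3) ^ (n + 2) * (‖configFourierCoeff L Ψ.ψ ν‖₊ : ℝ≥0∞) ^ 2 = 1 := by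
  rw [ENNReal.tsum_mul_left, tsum_sq_configFourierCoeff hL Ψ.contDiff.continuous, Ψ.norm_eq, mul_one,
    ← mul_pow, ENNReal.mul_inv_cancel (pow_ne_zero _ (ENNReal.ofReal_pos.2 hL).ne')
      (ENNReal.pow_ne_top ENNReal.ofReal_ne_top), one_pow]

/-- A multiplicity is at most the number of particles: `m_q(ν) ≤ n + 2`. [folklore] -/
theorem card_filter_le (q : Fin 3 → ℤ) (ν : Fin (n + 2) × Fin 3 → ℤ) :
    (((Finset.univ.filter fun j : Fin (n + 2) => (fun c => ν (j, c)) = q).card : ℕ) : ℝ) ≤ n + 2 := by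
  have h := (Finset.univ.filter fun j : Fin (n + 2) => (fun c => ν (j, c)) = q).card_le_univ
  rw [Fintype.card_fin] at h
  exact_mod_cast h

/-- **The moment inequality** for a normalised core state `Ψ` of `n + 2` bosons and `k ≠ 0`:
`N‖a_kΨ‖² − ‖a_k a_0Ψ‖² ≤ (N/2)‖a_kΨ‖² + N (‖a_0a_0Ψ‖² + ‖a_0Ψ‖² − ‖a_0Ψ‖⁴) / (‖a_0Ψ‖² − N/2)`
whenever `‖a_0Ψ‖² > N/2` (`N = n + 2`). [folklore] -/
theorem momentIneq (hL : 0 < L) {k : Fin 3 → ℤ} (hk : k ≠ 0) (Ψ : PeriodicTrialState (n + 2) L)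
    (hc : (n + 2 : ℝ) / 2 < (normSq L (modeAn L (planeWaveMode L 0) Ψ.ψ)).toReal) :
    (n + 2 : ℝ) * (normSq L (modeAn L (planeWaveMode L k) Ψ.ψ)).toReal -
        (normSq L (modeAn L (planeWaveMode L k) (modeAn L (planeWaveMode L 0) Ψ.ψ))).toReal ≤
      (n + 2 : ℝ) / 2 * (normSq L (modeAn L (planeWaveMode L k) Ψ.ψ)).toReal +
        (n + 2 : ℝ) *
            ((normSq L (modeAn L (planeWaveMode L 0) (modeAn L (planeWaveMode L 0) Ψ.ψ))).toReal +
              (normSq L (modeAn L (planeWaveMode L 0) Ψ.ψ)).toReal -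
              (normSq L (modeAn L (planeWaveMode L 0) Ψ.ψ)).toReal ^ 2) /
          ((normSq L (modeAn L (planeWaveMode L 0) Ψ.ψ)).toReal - (n + 2 : ℝ) / 2) := by
  have hΨ : IsCore L Ψ.ψ := isCore_trialState Ψ
  rw [normSq_modeAn_eq_tsum_weight hL 0 hΨ] at hc
  rw [normSq_modeAn_eq_tsum_weight hL k hΨ, normSq_modeAn_eq_tsum_weight hL 0 hΨ,
    normSq_modeAn_modeAn_eq_tsum_weight hL k 0 hΨ, normSq_modeAn_modeAn_eq_tsum_weight hL 0 0 hΨ]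
  simp only [if_neg hk, if_true, Nat.sub_zero]
  exact toReal_tsum_ineq (tsum_weight_eq_one hL Ψ) (fun ν => card_filter_le 0 ν)
    (fun ν => card_filter_le k ν) hc

end MomentIneq

/-- **Registered helper sub-goal `stub_fsumMomentIneq`** (line `fsum-phase-pencil`, S5-M): the moment inequality
`N·n_k − ⟨n₀n_k⟩ ≤ (N/2)·n_k + N·Var(n₀)/(n̄₀ − N/2)` for a normalised core state with `n̄₀ > N/2`
(`MomentIneq.momentIneq`). [folklore] -/
theorem stub_fsumMomentIneq : ∀ {n : ℕ} {L : ℝ}, 0 < L → ∀ {k : Fin 3 → ℤ}, k ≠ 0 → ∀ (Ψ : PeriodicTrialState (n + 2) L), (n + 2 : ℝ) / 2 < (normSq L (modeAn L (planeWaveMode L 0) Ψ.ψ)).toReal → (n + 2 : ℝ) * (normSq L (modeAn L (planeWaveMode L k) Ψ.ψ)).toReal - (normSq L (modeAn L (planeWaveMode L k) (modeAn L (planeWaveMode L 0) Ψ.ψ))).toReal ≤ (n + 2 : ℝ) / 2 * (normSq L (modeAn L (planeWaveMode L k) Ψ.ψ)).toReal + (n + 2 : ℝ) * ((normSq L (modeAn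 L (planeWaveMode L 0) (modeAn L (planeWaveMode L 0) Ψ.ψ))).toReal + (normSq L (modeAn L (planeWaveMode L 0) Ψ.ψ)).toReal - (normSq L (modeAn L (planeWaveMode L 0) Ψ.ψ)).toReal ^ 2) / ((normSq L (modeAn L (planeWaveMode L 0) Ψ.ψ)).toReal - (n + 2 : ℝ) / 2) :=
  fun hL _ hk Ψ hc => MomentIneq.momentIneq hL hk Ψ hc

end Summit.AtomisticToContinuum.BoseEinsteinCondensation.Cruxes.PeriodicIRBound.FsumPhasePencil

end
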